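import Summits.CriticalPhenomena.PercolationContinuityZ3.Theorems.PercNearOneGluingNoHeavyLowerTailSahiGridPatternHarrisEqualityPrelim

/-!
# `NoHeavyLowerTail` (crux stmt-CriticalPhenomena-4575), Sahi programme P1: **THE EQUALITY CASE OF COEFFICIENTWISE HARRIS ON `[3]^n`** —
# the two-copy slack `2^n|U∩V| − N(U;V)` of two up-sets vanishes iff the two up-sets live on disjoint blocks of axes; hence the
# **ZERO LOCUS OF THE PATTERN FUNCTIONAL ON THE INDEPENDENT-PAIR FACE IS EXACTLY THE SATURATED FAMILY** (every dimension)

Support file (Sahi cell, seat `prim-sahi-p1`, generation 14; `--supports stmt-CriticalPhenomena-4575`).  Pure proofs, no definitions, no `sorry`,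
standard axioms.  Vocabulary of `…SahiGridPattern{,Harris,IndepSlots,ZeroLocus}` (`Pd`, `ind`, `TotDist`, `sum_ind_totDist_le`, `offdiag_le_two_diag`,
`ind_filter_snoc`, `isUpperSet_filter_snoc`, `ind_snoc_mono`, `sum_snoc`, `totDist_snoc_iff`, `sum_td_meet_eq_pow_mul_diag`,
`sStarD_eq_two_harrisSlacks_of_indepSlots`, `sStarD_eq_zero_of_indepSlots_saturated`).

THE MATHEMATICS.  `N(U;V) = #{(p,q) ∈ U × V : p, q differ in every axis}`.  Coefficientwise Harris (`sum_ind_totDist_le`, lane prim-ineq-gen-4): for up-sets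
`N(U;V) ≤ 2^n|U ∩ V|`.  **THEOREM (`exists_indep_of_harrisSlack_eq_zero`, every `n`).**  If `U, V ⊆ [3]^n` are up-sets with `N(U;V) = 2^n|U ∩ V|`, then there is a
set of axes `I` such that membership in `U` depends only on the coordinates in `I` and membership in `V` only on the coordinates outside `I`.
(The converse is `sum_td_meet_eq_pow_mul_diag` of `…ZeroLocus` with `C = ⊤`.)  PROOF: induction on `n` along the Harris induction.  Slicing the last
axis, `2^{n+1}|U∩V| − N(U;V) = Σ_{i≠j} (2^n|U_i ∩ V_j| − N(U_i;V_j)) + 2^n Σ_p D(p)` with every bracket `≥ 0` (induction hypothesis' inequality) and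
`D(p) = 2Σ_i u_i v_i − Σ_{i≠j} u_i v_j ≥ 0` (`u_i = 1_{U_i}(p)` nested); so equality forces (1) `N(U_i;V_j) = 2^n|U_i∩V_j|` for `i ≠ j` — by induction
`U_i ⊥ V_j` via some block `I_{ij}` — and (2) `D ≡ 0`, i.e. NO point lies in `(U_2 ∖ U_0) ∩ (V_2 ∖ V_0)`.  If `U_2 ⊆ U_0` (all slices of `U` equal) then
`I := I_{10} ∩ I_{01} ∩ I_{02}` works (the last axis goes to `V`); if `V_2 ⊆ V_0`, `I := I_{01} ∪ I_{10} ∪ I_{20} ∪ {last}` works; otherwise pick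
`p ∈ U_2 ∖ U_0`, `q ∈ V_2 ∖ V_0` and glue them along the blocks `I_{20}, I_{02}`:
`r_c = p_c` on `I_{20} ∩ I_{02}`, `max(p_c,q_c)` on `I_{20} ∖ I_{02}`, `min(p_c,q_c)` on `I_{02} ∖ I_{20}`, `q_c` elsewhere — then `r ∈ U_2 ∖ U_0` and
`r ∈ V_2 ∖ V_0` by block measurability and monotonicity, contradicting (2).  ∎
**COROLLARY (`sStarD_eq_zero_iff_saturated_of_indepSlots`, file `…SahiGridPatternZeroLocusIndep`, every `d`).**  For up-sets `A` (`I`-measurable), `B` (`J`-measurable, `I ∩ J = ∅`) and `C`: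
`sStarD A B C = 0 ⟺ (∃ I', A I'-measurable ∧ B ∩ C invariant under changing the I'-coordinates) ∧ (∃ J', B J'-measurable ∧ A ∩ C invariant under changing
the J'-coordinates)` — by the two-slack formula `sStarD A B C = (2^d|ABC| − N(A;BC)) + (2^d|ABC| − N(B;AC))` (…ZeroLocus) each slack vanishes, and the theorem
above converts a vanishing slack into a block structure; the reverse implication is `sStarD_eq_zero_of_indepSlots_saturated` on the blocks `I ∩ I'`, `J ∩ J'`.
So on the independent-pair face of `PatternPos` the zero locus is EXACTLY the saturated family (census, generation-14 memo: `d ≤ 3` exhaustive, `d = 4, 5`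
sampled agree).  HONEST LABEL: identities / equality cases only; `PatternPos d` (`d ≥ 5`), Sahi's `C₃` and Kahn's conjecture remain OPEN. [this work]
-/

namespace Summit.CriticalPhenomena.PercolationContinuityZ3.Theorems.SahiGridPattern

open Finset SahiGrid3
open scoped BigOperators

variable {n : ℕ}

/-! ### The equality case of coefficientwise Harris -/

/-- **EQUALITY IN COEFFICIENTWISE HARRIS FORCES INDEPENDENCE** (every `n`): if the up-sets `U, V ⊆ [3]^n` satisfy
`Σ_{p,q} 1_U(p)1_V(q)[p δ̸ q] = 2^n Σ_p 1_U(p)1_V(p)`, then for some block of axes `I`, membership in `U` depends only on the coordinates in `I` and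
membership in `V` only on the coordinates outside `I`. [this work] -/
theorem exists_indep_of_harrisSlack_eq_zero : ∀ (n : ℕ) (U V : Finset (Pd n)), IsUpperSet (U : Set (Pd n)) → IsUpperSet (V : Set (Pd n)) →
    (∑ p, ∑ q, ind U p * ind V q * (if TotDist p q = true then (1 : ℤ) else 0)) = 2 ^ n * ∑ p, ind U p * ind V p →
    ∃ I : Finset (Fin n), (∀ x y : Pd n, (∀ a ∈ I, x a = y a) → (x ∈ U ↔ y ∈ U)) ∧
      (∀ x y : Pd n, (∀ a ∉ I, x a = y a) → (x ∈ V ↔ y ∈ V)) := by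
  intro n
  induction n with
  | zero =>
    intro U V _ _ _
    refine ⟨∅, fun x y _ => ?_, fun x y _ => ?_⟩
    · have : x = y := funext fun a => a.elim0
      rw [this]
    · have : x = y := funext fun a => a.elim0
      rw [this]
  | succ n ih =>
    intro U V hU hV heq
    -- the slices
    set Us : Fin 3 → Finset (Pd n) := fun i => univ.filter fun p : Pd n => (Fin.snoc p i : Pd (n + 1)) ∈ U with hUs
    set Vs : Fin 3 → Finset (Pd n) := fun i => univ.filter fun p : Pd n => (Fin.snoc p i : Pd (n + 1)) ∈ V with hVs
    have hUsup : ∀ i, IsUpperSet ((Us i : Finset (Pd n)) : Set (Pd n)) := fun i => by rw [hUs]; exact isUpperSet_filter_snoc hU i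
    have hVsup : ∀ i, IsUpperSet ((Vs i : Finset (Pd n)) : Set (Pd n)) := fun i => by rw [hVs]; exact isUpperSet_filter_snoc hV i
    have memUs : ∀ i (p : Pd n), p ∈ Us i ↔ (Fin.snoc p i : Pd (n + 1)) ∈ U := fun i p => by
      rw [hUs]; simp only [mem_filter, mem_univ, true_and]
    have memVs : ∀ i (p : Pd n), p ∈ Vs i ↔ (Fin.snoc p i : Pd (n + 1)) ∈ V := fun i p => by
      rw [hVs]; simp only [mem_filter, mem_univ, true_and]
    have hU' : ∀ i p, ind U (Fin.snoc p i) = ind (Us i) p := fun i p => (ind_filter_snoc U i p).symm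
    have hV' : ∀ i p, ind V (Fin.snoc p i) = ind (Vs i) p := fun i p => (ind_filter_snoc V i p).symm
    -- nestedness of the slices
    have Us_mono : ∀ {i j : Fin 3}, i ≤ j → Us i ⊆ Us j := fun {i j} hij p hp =>
      (memUs j p).2 (hU (snoc_le_snoc_of_le p hij) ((memUs i p).1 hp))
    have Vs_mono : ∀ {i j : Fin 3}, i ≤ j → Vs i ⊆ Vs j := fun {i j} hij p hp =>
      (memVs j p).2 (hV (snoc_le_snoc_of_le p hij) ((memVs i p).1 hp))
    have htd : ∀ (p q : Pd n) (i j : Fin 3), (if TotDist (Fin.snoc p i : Pd (n + 1)) (Fin.snoc q j) = true then (1 : ℤ) else 0) =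
        (if TotDist p q = true then (1 : ℤ) else 0) * (if i ≠ j then 1 else 0) := by
      intro p q i j
      by_cases h1 : TotDist p q = true
      · by_cases h2 : i ≠ j
        · rw [if_pos ((totDist_snoc_iff p q i j).2 ⟨h1, h2⟩), if_pos h1, if_pos h2]; ring
        · rw [if_neg (fun h => h2 ((totDist_snoc_iff p q i j).1 h).2), if_pos h1, if_neg h2]; ring
      · rw [if_neg (fun h => h1 ((totDist_snoc_iff p q i j).1 h).1), if_neg h1]; ring
    -- slice the left-hand side (as in `sum_ind_totDist_le`)
    have hL : (∑ p : Pd (n + 1), ∑ q : Pd (n + 1), ind U p * ind V q * (if TotDist p q = true then (1 : ℤ) else 0)) =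
        ∑ i : Fin 3, ∑ j : Fin 3, (if i ≠ j then (1 : ℤ) else 0) *
          (∑ p : Pd n, ∑ q : Pd n, ind (Us i) p * ind (Vs j) q * (if TotDist p q = true then (1 : ℤ) else 0)) := by
      rw [sum_snoc (fun p : Pd (n + 1) => ∑ q : Pd (n + 1), ind U p * ind V q * (if TotDist p q = true then (1 : ℤ) else 0))]
      refine Finset.sum_congr rfl fun i _ => ?_
      have inner : ∀ p : Pd n, (∑ q : Pd (n + 1), ind U (Fin.snoc p i) * ind V q *
          (if TotDist (Fin.snoc p i : Pd (n + 1)) q = true then (1 : ℤ) else 0)) =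
          ∑ j : Fin 3, ∑ q : Pd n, (if i ≠ j then (1 : ℤ) else 0) *
            (ind (Us i) p * ind (Vs j) q * (if TotDist p q = true then (1 : ℤ) else 0)) := by
        intro p
        rw [sum_snoc (fun q : Pd (n + 1) => ind U (Fin.snoc p i) * ind V q *
          (if TotDist (Fin.snoc p i : Pd (n + 1)) q = true then (1 : ℤ) else 0))]
        refine Finset.sum_congr rfl fun j _ => Finset.sum_congr rfl fun q _ => ?_
        rw [hU', hV', htd]; ring
      rw [Finset.sum_congr rfl fun p _ => inner p, Finset.sum_comm]
      refine Finset.sum_congr rfl fun j _ => ?_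
      rw [Finset.mul_sum]
      refine Finset.sum_congr rfl fun p _ => ?_
      rw [Finset.mul_sum]
    -- slice the right-hand side
    have hR : (∑ p : Pd (n + 1), ind U p * ind V p) = ∑ p : Pd n, ∑ i : Fin 3, ind (Us i) p * ind (Vs i) p := by
      rw [sum_snoc (fun p : Pd (n + 1) => ind U p * ind V p), Finset.sum_comm]
      refine Finset.sum_congr rfl fun p _ => Finset.sum_congr rfl fun i _ => ?_
      rw [hU', hV']
    -- the chain of inequalities whose ends coincide
    have hblock : ∀ i j : Fin 3, (if i ≠ j then (1 : ℤ) else 0) *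
          (∑ p : Pd n, ∑ q : Pd n, ind (Us i) p * ind (Vs j) q * (if TotDist p q = true then (1 : ℤ) else 0)) ≤
        (if i ≠ j then (1 : ℤ) else 0) * (2 ^ n * ∑ p : Pd n, ind (Us i) p * ind (Vs j) p) := by
      intro i j
      have hih := sum_ind_totDist_le n (Us i) (Vs j) (hUsup i) (hVsup j)
      by_cases hij : i ≠ j
      · rw [if_pos hij, one_mul, one_mul]; exact hih
      · rw [if_neg hij, zero_mul, zero_mul]
    have hpt : ∀ p : Pd n, (∑ i : Fin 3, ∑ j : Fin 3, (if i ≠ j then (1 : ℤ) else 0) * (ind (Us i) p * ind (Vs j) p)) ≤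
        2 * ∑ i : Fin 3, ind (Us i) p * ind (Vs i) p := by
      intro p
      have m01U := ind_snoc_mono hU p (show (0 : Fin 3) ≤ 1 by decide)
      have m12U := ind_snoc_mono hU p (show (1 : Fin 3) ≤ 2 by decide)
      have m01V := ind_snoc_mono hV p (show (0 : Fin 3) ≤ 1 by decide)
      have m12V := ind_snoc_mono hV p (show (1 : Fin 3) ≤ 2 by decide)
      rw [hU', hU'] at m01U m12U; rw [hV', hV'] at m01V m12V
      have key := offdiag_le_two_diag (ind (Us 0) p) (ind (Us 1) p) (ind (Us 2) p) (ind (Vs 0) p) (ind (Vs 1) p) (ind (Vs 2) p)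
        (ind_eq_zero_or_one _ _) (ind_eq_zero_or_one _ _) (ind_eq_zero_or_one _ _) m01U m12U m01V m12V
      simp only [Fin.sum_univ_three]
      simp only [ne_eq, not_true_eq_false, if_false, zero_mul, Fin.isValue, zero_add, add_zero]
      have h01 : ((0 : Fin 3) = 1) = False := by decide
      have h02 : ((0 : Fin 3) = 2) = False := by decide
      have h10 : ((1 : Fin 3) = 0) = False := by decide
      have h12 : ((1 : Fin 3) = 2) = False := by decide
      have h20 : ((2 : Fin 3) = 0) = False := by decide
      have h21 : ((2 : Fin 3) = 1) = False := by decide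
      simp only [h01, h02, h10, h12, h20, h21, not_false_eq_true, if_true, one_mul]
      linarith
    have hre : (∑ i : Fin 3, ∑ j : Fin 3, (if i ≠ j then (1 : ℤ) else 0) * (2 ^ n * ∑ p : Pd n, ind (Us i) p * ind (Vs j) p)) =
        2 ^ n * ∑ p : Pd n, (∑ i : Fin 3, ∑ j : Fin 3, (if i ≠ j then (1 : ℤ) else 0) * (ind (Us i) p * ind (Vs j) p)) := by
      set F : Fin 3 → Fin 3 → Pd n → ℤ := fun i j p => (2 : ℤ) ^ n * ((if i ≠ j then (1 : ℤ) else 0) * (ind (Us i) p * ind (Vs j) p)) with hF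
      have e1 : (∑ i : Fin 3, ∑ j : Fin 3, (if i ≠ j then (1 : ℤ) else 0) * (2 ^ n * ∑ p : Pd n, ind (Us i) p * ind (Vs j) p)) =
          ∑ i : Fin 3, ∑ j : Fin 3, ∑ p : Pd n, F i j p := by
        refine Finset.sum_congr rfl fun i _ => Finset.sum_congr rfl fun j _ => ?_
        rw [hF, Finset.mul_sum, Finset.mul_sum]
        refine Finset.sum_congr rfl fun p _ => ?_
        ring
      have e2 : (∑ i : Fin 3, ∑ j : Fin 3, ∑ p : Pd n, F i j p) = ∑ i : Fin 3, ∑ p : Pd n, ∑ j : Fin 3, F i j p :=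
        Finset.sum_congr rfl fun i _ => Finset.sum_comm
      have e3 : (∑ i : Fin 3, ∑ p : Pd n, ∑ j : Fin 3, F i j p) = ∑ p : Pd n, ∑ i : Fin 3, ∑ j : Fin 3, F i j p := Finset.sum_comm
      have e4 : (2 : ℤ) ^ n * ∑ p : Pd n, (∑ i : Fin 3, ∑ j : Fin 3, (if i ≠ j then (1 : ℤ) else 0) * (ind (Us i) p * ind (Vs j) p)) =
          ∑ p : Pd n, ∑ i : Fin 3, ∑ j : Fin 3, F i j p := by
        rw [Finset.mul_sum]
        refine Finset.sum_congr rfl fun p _ => ?_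
        rw [Finset.mul_sum]
        refine Finset.sum_congr rfl fun i _ => ?_
        rw [Finset.mul_sum]
      rw [e1, e2, e3, e4]
    -- abbreviations for the four stations of the chain
    set S1 := ∑ i : Fin 3, ∑ j : Fin 3, (if i ≠ j then (1 : ℤ) else 0) *
          (∑ p : Pd n, ∑ q : Pd n, ind (Us i) p * ind (Vs j) q * (if TotDist p q = true then (1 : ℤ) else 0)) with hS1
    set S2 := ∑ i : Fin 3, ∑ j : Fin 3, (if i ≠ j then (1 : ℤ) else 0) * (2 ^ n * ∑ p : Pd n, ind (Us i) p * ind (Vs j) p) with hS2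
    set X := ∑ p : Pd n, (∑ i : Fin 3, ∑ j : Fin 3, (if i ≠ j then (1 : ℤ) else 0) * (ind (Us i) p * ind (Vs j) p)) with hX
    set Y := ∑ p : Pd n, (2 * ∑ i : Fin 3, ind (Us i) p * ind (Vs i) p) with hY
    have h12 : S1 ≤ S2 := Finset.sum_le_sum fun i _ => Finset.sum_le_sum fun j _ => hblock i j
    have hXY : X ≤ Y := Finset.sum_le_sum fun p _ => hpt p
    have hS2X : S2 = 2 ^ n * X := hre
    have hYend : (2 : ℤ) ^ n * Y = 2 ^ (n + 1) * ∑ p : Pd (n + 1), ind U p * ind V p := by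
      rw [hR, hY, ← Finset.mul_sum, pow_succ]; ring
    have hend : (2 : ℤ) ^ (n + 1) * ∑ p : Pd (n + 1), ind U p * ind V p = S1 := by rw [← heq, hL]
    have h2n : (0 : ℤ) < 2 ^ n := pow_pos (by norm_num) n
    -- both inequalities are equalities
    have hS12 : S1 = S2 := by
      have : 2 ^ n * X ≤ 2 ^ n * Y := mul_le_mul_of_nonneg_left hXY h2n.le
      have h' : S2 ≤ S1 := by rw [hS2X]; calc (2:ℤ) ^ n * X ≤ 2 ^ n * Y := this
        _ = S1 := by rw [hYend, hend]
      exact le_antisymm h12 h'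
    have hXYeq : X = Y := by
      have h' : 2 ^ n * Y ≤ 2 ^ n * X := by
        rw [← hS2X, ← hS12, ← hend, ← hYend]
      exact le_antisymm hXY (le_of_mul_le_mul_left h' h2n)
    -- (1) every off-diagonal slice pair is Harris-tight
    have hpair : ∀ i j : Fin 3, i ≠ j →
        (∑ p : Pd n, ∑ q : Pd n, ind (Us i) p * ind (Vs j) q * (if TotDist p q = true then (1 : ℤ) else 0)) =
          2 ^ n * ∑ p : Pd n, ind (Us i) p * ind (Vs j) p := by
      have houter := (Finset.sum_eq_sum_iff_of_le (fun i _ => Finset.sum_le_sum fun j _ => hblock i j)).1 hS12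
      intro i j hij
      have hinner := (Finset.sum_eq_sum_iff_of_le (fun j _ => hblock i j)).1 (houter i (mem_univ i)) j (mem_univ j)
      rw [if_pos hij, one_mul, one_mul] at hinner
      exact hinner
    -- (2) no point lies strictly inside both last-axis increments
    have hnoboth : ∀ p : Pd n, ¬ (p ∈ Us 2 ∧ p ∉ Us 0 ∧ p ∈ Vs 2 ∧ p ∉ Vs 0) := by
      intro p ⟨h1, h2, h3, h4⟩
      have hp := (Finset.sum_eq_sum_iff_of_le (fun p _ => hpt p)).1 hXYeq p (mem_univ p)
      have m01U := ind_snoc_mono hU p (show (0 : Fin 3) ≤ 1 by decide)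
      have m12U := ind_snoc_mono hU p (show (1 : Fin 3) ≤ 2 by decide)
      have m01V := ind_snoc_mono hV p (show (0 : Fin 3) ≤ 1 by decide)
      have m12V := ind_snoc_mono hV p (show (1 : Fin 3) ≤ 2 by decide)
      rw [hU', hU'] at m01U m12U; rw [hV', hV'] at m01V m12V
      simp only [Fin.sum_univ_three] at hp
      simp only [ne_eq, not_true_eq_false, if_false, zero_mul, Fin.isValue, zero_add, add_zero] at hp
      have h01 : ((0 : Fin 3) = 1) = False := by decide
      have h02 : ((0 : Fin 3) = 2) = False := by decide
      have h10 : ((1 : Fin 3) = 0) = False := by decide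
      have h12' : ((1 : Fin 3) = 2) = False := by decide
      have h20 : ((2 : Fin 3) = 0) = False := by decide
      have h21 : ((2 : Fin 3) = 1) = False := by decide
      simp only [h01, h02, h10, h12', h20, h21, not_false_eq_true, if_true, one_mul] at hp
      have key := offdiag_eq_two_diag_cases (ind (Us 0) p) (ind (Us 1) p) (ind (Us 2) p) (ind (Vs 0) p) (ind (Vs 1) p) (ind (Vs 2) p)
        (ind_eq_zero_or_one _ _) (ind_eq_zero_or_one _ _) (ind_eq_zero_or_one _ _) (ind_eq_zero_or_one _ _) (ind_eq_zero_or_one _ _)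
        (ind_eq_zero_or_one _ _) m01U m12U m01V m12V (by linarith)
      have e1 : ind (Us 2) p = 1 := if_pos h1
      have e2 : ind (Us 0) p = 0 := if_neg h2
      have e3 : ind (Vs 2) p = 1 := if_pos h3
      have e4 : ind (Vs 0) p = 0 := if_neg h4
      rw [e1, e2, e3, e4] at key
      omega
    -- the induction hypothesis on the off-diagonal slice pairs
    have hI : ∀ i j : Fin 3, i ≠ j → ∃ I : Finset (Fin n), (∀ x y : Pd n, (∀ a ∈ I, x a = y a) → (x ∈ Us i ↔ y ∈ Us i)) ∧
        (∀ x y : Pd n, (∀ a ∉ I, x a = y a) → (x ∈ Vs j ↔ y ∈ Vs j)) :=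
      fun i j hij => ih (Us i) (Vs j) (hUsup i) (hVsup j) (hpair i j hij)
    -- decomposition of a point of `[3]^{n+1}`
    have decomp : ∀ x : Pd (n + 1), x = Fin.snoc (Fin.init x) (x (Fin.last n)) := fun x => (Fin.snoc_init_self x).symm
    have memU : ∀ x : Pd (n + 1), x ∈ U ↔ Fin.init x ∈ Us (x (Fin.last n)) := fun x => by
      rw [memUs]; constructor
      · intro h; rw [← decomp x]; exact h
      · intro h; rw [decomp x]; exact h
    have memV : ∀ x : Pd (n + 1), x ∈ V ↔ Fin.init x ∈ Vs (x (Fin.last n)) := fun x => by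
      rw [memVs]; constructor
      · intro h; rw [← decomp x]; exact h
      · intro h; rw [decomp x]; exact h
    have last_not_mem : ∀ I : Finset (Fin n), Fin.last n ∉ I.map Fin.castSuccEmb := fun I h => by
      obtain ⟨c, _, hc⟩ := Finset.mem_map.1 h
      exact absurd hc (Fin.castSucc_lt_last c).ne
    have cast_mem : ∀ (I : Finset (Fin n)) (c : Fin n), Fin.castSucc c ∈ I.map Fin.castSuccEmb ↔ c ∈ I := fun I c => by
      constructor
      · intro h
        obtain ⟨c', hc', e⟩ := Finset.mem_map.1 h
        have e' : Fin.castSucc c' = Fin.castSucc c := e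
        rw [Fin.castSucc_inj.1 e'] at hc'
        exact hc'
      · intro h
        exact Finset.mem_map_of_mem Fin.castSuccEmb h
    -- Case analysis
    by_cases hA : Us 2 ⊆ Us 0
    · -- all slices of `U` coincide: the last axis goes to `V`
      have hUeq : ∀ i, Us i = Us 0 := fun i =>
        Finset.Subset.antisymm ((Us_mono (Fin.le_last i)).trans hA) (Us_mono (Fin.zero_le i))
      obtain ⟨I10, hU10, hV10⟩ := hI 1 0 (by decide)
      obtain ⟨I01, hU01, hV01⟩ := hI 0 1 (by decide)
      obtain ⟨I02, hU02, hV02⟩ := hI 0 2 (by decide)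
      rw [hUeq 1] at hU10
      have hUI : ∀ x y : Pd n, (∀ a ∈ I10 ∩ I01 ∩ I02, x a = y a) → (x ∈ Us 0 ↔ y ∈ Us 0) := meas_inter (meas_inter hU10 hU01) hU02
      refine ⟨(I10 ∩ I01 ∩ I02).map Fin.castSuccEmb, fun x y hxy => ?_, fun x y hxy => ?_⟩
      · rw [memU x, memU y, hUeq, hUeq (y (Fin.last n))]
        exact hUI _ _ fun c hc => hxy (Fin.castSucc c) ((cast_mem _ c).2 hc)
      · have hlast : x (Fin.last n) = y (Fin.last n) := hxy _ (last_not_mem _)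
        rw [memV x, memV y, hlast]
        have hoff : ∀ c : Fin n, c ∉ I10 ∩ I01 ∩ I02 → Fin.init x c = Fin.init y c := fun c hc =>
          hxy (Fin.castSucc c) (fun h => hc ((cast_mem _ c).1 h))
        -- each `Vs j` is co-measurable w.r.t. its own block, hence w.r.t. the intersection
        have gen : ∀ (j : Fin 3) (Ij : Finset (Fin n)), I10 ∩ I01 ∩ I02 ⊆ Ij →
            (∀ x y : Pd n, (∀ a ∉ Ij, x a = y a) → (x ∈ Vs j ↔ y ∈ Vs j)) → (Fin.init x ∈ Vs j ↔ Fin.init y ∈ Vs j) :=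
          fun j Ij hsub hVj => hVj _ _ fun c hc => hoff c (fun h => hc (hsub h))
        have all : ∀ j : Fin 3, (Fin.init x ∈ Vs j ↔ Fin.init y ∈ Vs j) := by
          intro j
          fin_cases j
          · show Fin.init x ∈ Vs 0 ↔ Fin.init y ∈ Vs 0
            exact gen 0 I10 (fun a ha => (Finset.mem_inter.1 (Finset.mem_inter.1 ha).1).1) hV10
          · show Fin.init x ∈ Vs 1 ↔ Fin.init y ∈ Vs 1
            exact gen 1 I01 (fun a ha => (Finset.mem_inter.1 (Finset.mem_inter.1 ha).1).2) hV01
          · show Fin.init x ∈ Vs 2 ↔ Fin.init y ∈ Vs 2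
            exact gen 2 I02 (fun a ha => (Finset.mem_inter.1 ha).2) hV02
        exact all _
    · by_cases hB : Vs 2 ⊆ Vs 0
      · -- all slices of `V` coincide: the last axis goes to `U`
        have hVeq : ∀ i, Vs i = Vs 0 := fun i =>
          Finset.Subset.antisymm ((Vs_mono (Fin.le_last i)).trans hB) (Vs_mono (Fin.zero_le i))
        obtain ⟨I01, hU01, hV01⟩ := hI 0 1 (by decide)
        obtain ⟨I10, hU10, hV10⟩ := hI 1 0 (by decide)
        obtain ⟨I20, hU20, hV20⟩ := hI 2 0 (by decide)
        rw [hVeq 1] at hV01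
        have hVI : ∀ x y : Pd n, (∀ a ∉ I01 ∪ I10 ∪ I20, x a = y a) → (x ∈ Vs 0 ↔ y ∈ Vs 0) :=
          comeas_union (comeas_union hV01 hV10) hV20
        refine ⟨insert (Fin.last n) ((I01 ∪ I10 ∪ I20).map Fin.castSuccEmb), fun x y hxy => ?_, fun x y hxy => ?_⟩
        · have hlast : x (Fin.last n) = y (Fin.last n) := hxy _ (Finset.mem_insert_self _ _)
          rw [memU x, memU y, hlast]
          have hon : ∀ c : Fin n, c ∈ I01 ∪ I10 ∪ I20 → Fin.init x c = Fin.init y c := fun c hc =>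
            hxy (Fin.castSucc c) (Finset.mem_insert_of_mem ((cast_mem _ c).2 hc))
          have gen : ∀ (i : Fin 3) (Ii : Finset (Fin n)), Ii ⊆ I01 ∪ I10 ∪ I20 →
              (∀ x y : Pd n, (∀ a ∈ Ii, x a = y a) → (x ∈ Us i ↔ y ∈ Us i)) → (Fin.init x ∈ Us i ↔ Fin.init y ∈ Us i) :=
            fun i Ii hsub hUi => hUi _ _ fun c hc => hon c (hsub hc)
          have all : ∀ i : Fin 3, (Fin.init x ∈ Us i ↔ Fin.init y ∈ Us i) := by
            intro i
            fin_cases i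
            · show Fin.init x ∈ Us 0 ↔ Fin.init y ∈ Us 0
              exact gen 0 I01 (fun a ha => Finset.mem_union_left _ (Finset.mem_union_left _ ha)) hU01
            · show Fin.init x ∈ Us 1 ↔ Fin.init y ∈ Us 1
              exact gen 1 I10 (fun a ha => Finset.mem_union_left _ (Finset.mem_union_right _ ha)) hU10
            · show Fin.init x ∈ Us 2 ↔ Fin.init y ∈ Us 2
              exact gen 2 I20 (fun a ha => Finset.mem_union_right _ ha) hU20
          exact all _
        · rw [memV x, memV y, hVeq, hVeq (y (Fin.last n))]
          refine hVI _ _ fun c hc => hxy (Fin.castSucc c) (fun h => ?_)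
          rcases Finset.mem_insert.1 h with h' | h'
          · exact absurd h' (Fin.castSucc_lt_last c).ne
          · exact hc ((cast_mem _ c).1 h')
      · -- both sets depend on the last axis: glue a point of `U₂ ∖ U₀` with a point of `V₂ ∖ V₀` — contradiction
        exfalso
        obtain ⟨p, hp2, hp0⟩ := Finset.not_subset.1 hA
        obtain ⟨q, hq2, hq0⟩ := Finset.not_subset.1 hB
        obtain ⟨I20, hU20, hV20⟩ := hI 2 0 (by decide)
        obtain ⟨I02, hU02, hV02⟩ := hI 0 2 (by decide)
        let r : Pd n := fun c => if c ∈ I20 then (if c ∈ I02 then p c else max (p c) (q c))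
          else (if c ∈ I02 then min (p c) (q c) else q c)
        have r1 : r ∈ Us 2 := by
          refine mem_of_le_on_of_meas (hUsup 2) (P := fun a => a ∈ I20) (fun x y h => hU20 x y h) hp2 fun a ha => ?_
          show p a ≤ (if a ∈ I20 then (if a ∈ I02 then p a else max (p a) (q a)) else (if a ∈ I02 then min (p a) (q a) else q a))
          rw [if_pos ha]
          by_cases hb : a ∈ I02
          · rw [if_pos hb]
          · rw [if_neg hb]; exact le_max_left _ _
        have r2 : r ∉ Us 0 := by
          refine not_mem_of_le_on_of_meas (hUsup 0) (P := fun a => a ∈ I02) (fun x y h => hU02 x y h) hp0 fun a ha => ?_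
          show (if a ∈ I20 then (if a ∈ I02 then p a else max (p a) (q a)) else (if a ∈ I02 then min (p a) (q a) else q a)) ≤ p a
          by_cases hb : a ∈ I20
          · rw [if_pos hb, if_pos ha]
          · rw [if_neg hb, if_pos ha]; exact min_le_left _ _
        have r3 : r ∈ Vs 2 := by
          refine mem_of_le_on_of_meas (hVsup 2) (P := fun a => a ∉ I02) (fun x y h => hV02 x y h) hq2 fun a ha => ?_
          show q a ≤ (if a ∈ I20 then (if a ∈ I02 then p a else max (p a) (q a)) else (if a ∈ I02 then min (p a) (q a) else q a))
          by_cases hb : a ∈ I20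
          · rw [if_pos hb, if_neg ha]; exact le_max_right _ _
          · rw [if_neg hb, if_neg ha]
        have r4 : r ∉ Vs 0 := by
          refine not_mem_of_le_on_of_meas (hVsup 0) (P := fun a => a ∉ I20) (fun x y h => hV20 x y h) hq0 fun a ha => ?_
          show (if a ∈ I20 then (if a ∈ I02 then p a else max (p a) (q a)) else (if a ∈ I02 then min (p a) (q a) else q a)) ≤ q a
          rw [if_neg ha]
          by_cases hb : a ∈ I02
          · rw [if_pos hb]; exact min_le_right _ _
          · rw [if_neg hb]
        exact hnoboth r ⟨r1, r2, r3, r4⟩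

/-- **The equality case of coefficientwise Harris, iff form** (every `n`): for up-sets `U, V ⊆ [3]^n`,
`N(U;V) = 2^n|U∩V|` iff `U` and `V` are measurable with respect to complementary blocks of axes. [this work] -/
theorem harrisSlack_eq_zero_iff (U V : Finset (Pd n)) (hU : IsUpperSet (U : Set (Pd n))) (hV : IsUpperSet (V : Set (Pd n))) :
    (∑ p, ∑ q, ind U p * ind V q * (if TotDist p q = true then (1 : ℤ) else 0)) = 2 ^ n * ∑ p, ind U p * ind V p ↔
      ∃ I : Finset (Fin n), (∀ x y : Pd n, (∀ a ∈ I, x a = y a) → (x ∈ U ↔ y ∈ U)) ∧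
        (∀ x y : Pd n, (∀ a ∉ I, x a = y a) → (x ∈ V ↔ y ∈ V)) := by
  constructor
  · exact exists_indep_of_harrisSlack_eq_zero n U V hU hV
  · rintro ⟨I, hUI, hVI⟩
    have h := sum_td_meet_eq_pow_mul_diag I (A := U) (B := V) (C := (univ : Finset (Pd n))) hUI hVI
      (fun x y _ _ => by simp only [Finset.mem_univ])
    have e1 : (∑ p, ∑ q, ind U p * ind V q * (if TotDist p q = true then (1 : ℤ) else 0)) =
        ∑ p, ∑ q, ind U p * ind V q * ind (univ : Finset (Pd n)) q * (if TotDist p q = true then (1 : ℤ) else 0) :=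
      Finset.sum_congr rfl fun p _ => Finset.sum_congr rfl fun q _ => by
        unfold ind; rw [if_pos (Finset.mem_univ q)]; ring
    have e2 : (∑ p, ind U p * ind V p) = ∑ p, ind U p * ind V p * ind (univ : Finset (Pd n)) p :=
      Finset.sum_congr rfl fun p _ => by unfold ind; rw [if_pos (Finset.mem_univ p)]; ring
    rw [e1, e2]; exact h

end Summit.CriticalPhenomena.PercolationContinuityZ3.Theorems.SahiGridPattern
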